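import Summits.CriticalPhenomena.PercolationContinuityZ3.Theorems.PercNearOneGluingNoHeavyPcintNawFreeZ4F12Defs
import HarnessLib

/-!
# PCINT lane, kernel reduced-state B2d (`nawfree`) certificate `Z4F12` (d = 4, memory τ = 12, delay kt = 4, 12932 state classes): row checks 6 (rows [1500, 1800))

Cell `prim-pcint`, seat `prim-pcint-1` (gen 7); memo `run/shared/lean/prim/pcint/REDUCTIONS.md` §B2d (delayed chain payments with
free-neighbour shares).  Does NOT build on p205010.  Data for `NawK.le_siteCriticalProb_of_checkRowsF` (`…PcintNawFreeMemKernelCert`):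
`p = 17090/100000`, weight table `Q_k/100000`, `Q = [82910, 82910, 91055, 93944, 95423, 96322, 96925, 97359, 97685]` (`Q_k^k·100000 ≥ (100000-17090)·100000^k`, nondecreasing), `λ = 99999/100000`; Collatz–Wielandt
weights (scale 10⁹) from a power iteration, exact off-line max row ratio 0.9994858418 < λ.  Generated by work/gen6/gen_free.py
(pcint-1 gen 6; run by gen 7); the kernel re-checks every row.
-/

namespace Summit.CriticalPhenomena.PercolationContinuityZ3.Theorems.Pcint.NawFreeZ4F12

set_option maxHeartbeats 0 in
/-- Rows `[1500, 1550)` pass the check. [folklore] -/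
theorem chk_1500 : WinK.allRange (NawK.checkRowF 12 4 4 12932 17090 100000 99999 100000 NawFreeZ4F12.QL NawFreeZ4F12.syms NawFreeZ4F12.tree) 1500 1550 = true :=
  WinK.allRange_of_allRangeB (fuel := 8) (lo := 1500) (len := 50) (by decide +kernel)

set_option maxHeartbeats 0 in
/-- Rows `[1550, 1600)` pass the check. [folklore] -/
theorem chk_1550 : WinK.allRange (NawK.checkRowF 12 4 4 12932 17090 100000 99999 100000 NawFreeZ4F12.QL NawFreeZ4F12.syms NawFreeZ4F12.tree) 1550 1600 = true :=
  WinK.allRange_of_allRangeB (fuel := 8) (lo := 1550) (len := 50) (by decide +kernel)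

set_option maxHeartbeats 0 in
/-- Rows `[1600, 1650)` pass the check. [folklore] -/
theorem chk_1600 : WinK.allRange (NawK.checkRowF 12 4 4 12932 17090 100000 99999 100000 NawFreeZ4F12.QL NawFreeZ4F12.syms NawFreeZ4F12.tree) 1600 1650 = true :=
  WinK.allRange_of_allRangeB (fuel := 8) (lo := 1600) (len := 50) (by decide +kernel)

set_option maxHeartbeats 0 in
/-- Rows `[1650, 1700)` pass the check. [folklore] -/
theorem chk_1650 : WinK.allRange (NawK.checkRowF 12 4 4 12932 17090 100000 99999 100000 NawFreeZ4F12.QL NawFreeZ4F12.syms NawFreeZ4F12.tree) 1650 1700 = true :=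
  WinK.allRange_of_allRangeB (fuel := 8) (lo := 1650) (len := 50) (by decide +kernel)

set_option maxHeartbeats 0 in
/-- Rows `[1700, 1750)` pass the check. [folklore] -/
theorem chk_1700 : WinK.allRange (NawK.checkRowF 12 4 4 12932 17090 100000 99999 100000 NawFreeZ4F12.QL NawFreeZ4F12.syms NawFreeZ4F12.tree) 1700 1750 = true :=
  WinK.allRange_of_allRangeB (fuel := 8) (lo := 1700) (len := 50) (by decide +kernel)

set_option maxHeartbeats 0 in
/-- Rows `[1750, 1800)` pass the check. [folklore] -/
theorem chk_1750 : WinK.allRange (NawK.checkRowF 12 4 4 12932 17090 100000 99999 100000 NawFreeZ4F12.QL NawFreeZ4F12.syms NawFreeZ4F12.tree) 1750 1800 = true :=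
  WinK.allRange_of_allRangeB (fuel := 8) (lo := 1750) (len := 50) (by decide +kernel)

/-- Rows `[1500, 1800)` pass the check. [folklore] -/
theorem file_6 : WinK.allRange (NawK.checkRowF 12 4 4 12932 17090 100000 99999 100000 NawFreeZ4F12.QL NawFreeZ4F12.syms NawFreeZ4F12.tree) 1500 1800 = true := (WinK.allRange_split (WinK.allRange_split (WinK.allRange_split (WinK.allRange_split (WinK.allRange_split chk_1500 chk_1550) chk_1600) chk_1650) chk_1700) chk_1750)

end Summit.CriticalPhenomena.PercolationContinuityZ3.Theorems.Pcint.NawFreeZ4F12
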